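import Literature.NumberTheory.LFunctions.NicolasOmega
import Literature.NumberTheory.LFunctions.RHClassicalEquivalentsRobinProofs
import Literature.NumberTheory.LFunctions.RobinSquarefreeOdd
import Literature.NumberTheory.LFunctions.ExtraordinaryNumbers
import Summits.RiemannHypothesis.Statement
import HarnessLib

/-!
# Splittings — Robin detectors II: the SIEVE REACH of tail-rigidity (even / non-squarefree carriers) and the
# margin-band currency of Robin's criterion (SPLIT-robin-bridge, gen 3; zero-definition raw form)

Cell rh-split, seat rh-split-robin-bridge g3 (brief sha16 f79c5f09d8bcb036), card
`run/shared/lean/pub/rh-split/cards/SPLIT-robin-bridge.md` §9 (gen-3 addendum); raw form of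
`HOME/rh-split-robin-bridge/SketchG3.lean` (sha16 6e7b4e4ad16078fa, 179 lines, zero defs; proofs verbatim).  The
g0 detector `CostumeDetectors.rh_of_robinTail` proved `TailRobin N → RH` for every `N` (Robin's tail is RH alone);
this file records the strictly larger reach of the TREE's RH-free class theorems (Ω-theorem + CLMS 2007):

* `rh_of_tailOn_of_sieve` — **sieve reach**: if an RH-free theorem confines every violator `n > N₀` of Robin's
  inequality to a set `V` (a «violator sieve»), then Robin's inequality on ANY `S` eventually containing `V` implies
  RH (`S` need not be cofinite);
* `rh_of_robin_even_tail` — Robin on the EVEN numbers beyond any `N` ⟹ RH (sieve =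
  CLMS 2007 Thm 2.1, tree `robinInequality_of_odd`; `S` co-infinite of density 1/2);
  `rh_of_robin_nonsquarefree_tail` — Robin on the NON-SQUAREFREE numbers beyond `N` ⟹ RH (sieve = CLMS 2007
  Thm 1.1, tree `robinInequality_of_squarefree_of_gt`; density `1 − 6/π²`); `rh_of_robin_even_nonsquarefree_tail` —
  sieves intersect;
* `rh_of_noBand` — MARGIN currency, modulo Robin's RH-free Thm 2 (named fact `Robin1984_thm2`, constant
  `C = (7/3 − e^γ log log 12)·log log 12 = 0.6482…`): «no `n > N` has `σ(n)/n` in the closed band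
  `[e^γ log log n, e^γ log log n + C/log log n]`» ⟹ RH (every violator lies in the band, so the band statement is
  the tail in disguise).

The converse directions (RH ⟹ Robin on every carrier beyond 5040, RH ⟹ empty band) are one-line consequences of
the tree's `Robin1984_thm1_holds`, which inherits the `native_decide` certificates of the Mertens/Schoenfeld
numerics; they are deliberately NOT restated here so that this file stays on the standard axioms (the scratch's
`tailOn_of_rh`, `robin_even_tail_iff_rh`, `noBand_of_rh`).

Deliberately NOT here: the EXPONENT currency of the scratch (Robin on the non-`t`-free numbers, `t ≤ 24`, modulo
the three named facts of the 24-free venture) — it imports `Summits.Ventures.RobinTFree.RobinTFree24`, outside the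
import policy of this directory; it stays in the seat's scratch.  Label (referee rh-split-ref g0, addendum 20:41Z:
replay rc 0, std on `rh_of_robin_even_tail` + `rh_of_noBand`): every row is RELABELLING — the tail on any sieve
carrier IS RH by theorem (tail-rigid; class UNCHANGED, barrier-note, 0 survivors).  Typer replay (rh-split-typer-1
g2): farm rc 0, 0 warnings, 0 sorry, std axioms.  Filed by rh-split-typer-1 g2 (lead HANDOFF §8, optional item).

HONEST LABEL: «SPLITTING SEARCH over kernel-typed RH-EQUIVALENCES; a splitting A ∧ B ⟹ RH is CONDITIONAL
bookkeeping unless A and B are both proved; nothing here bears on the truth of RH.»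
-/

set_option linter.dupNamespace false

noncomputable section

namespace Summit.RiemannHypothesis.RiemannHypothesis.Theorems.Splittings.RobinSieveDetectors

open Filter Real
open scoped ArithmeticFunction.sigma
open Literature.NumberTheory.LFunctions

/-- Under ¬RH there are violators beyond every bound (tree, unconditional: Robin 1984 §4 Prop. 1 =
`Robin1984_sigma_oscillation_holds`), read back as plain violations (as in g2). -/
theorem frequently_not_robin_of_not_RH (hRH : ¬ _root_.RiemannHypothesis) :
    ∃ᶠ n : ℕ in atTop, ¬ robinInequality n := by
  obtain ⟨β, C, hβ0, hβ, hC, hfreq⟩ := Robin1984_sigma_oscillation_holds hRH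
  have hev : ∀ᶠ n : ℕ in atTop, 5040 < n := eventually_gt_atTop _
  refine (hfreq.and_eventually hev).mono ?_
  rintro n ⟨hσ, hn⟩ hR
  unfold robinInequality at hR
  have hn0 : (0 : ℝ) < n := by exact_mod_cast (show 0 < n by omega)
  have hL1 : 1 < Real.log n := one_lt_log_natCast (by omega)
  have hL0 : 0 < Real.log n := by linarith
  have hLL : 0 < Real.log (Real.log n) := Real.log_pos hL1
  have hpos : 0 < C * n * Real.log (Real.log n) / Real.log n ^ β :=
    div_pos (mul_pos (mul_pos hC hn0) hLL) (Real.rpow_pos_of_pos hL0 β)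
  linarith

/-- **Sieve reach of tail-rigidity.** If (RH-free) every violator `n > N₀` of Robin's inequality lies
in `V`, and `S` contains every element of `V` beyond some `N`, then Robin's inequality on `S` (beyond
5040) implies RH.  `S` need not be cofinite. -/
theorem rh_of_tailOn_of_sieve {S V : Set ℕ} {N₀ : ℕ}
    (hV : ∀ n : ℕ, N₀ < n → ¬ robinInequality n → n ∈ V)
    (hSV : ∃ N : ℕ, ∀ n ∈ V, N < n → n ∈ S)
    (h : ∀ n ∈ S, 5040 < n → robinInequality n) : _root_.RiemannHypothesis := by
  by_contra hRH
  obtain ⟨N, hN⟩ := hSV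
  have hev : ∀ᶠ n : ℕ in atTop, N₀ < n ∧ N < n ∧ 5040 < n :=
    (eventually_gt_atTop N₀).and ((eventually_gt_atTop N).and (eventually_gt_atTop 5040))
  obtain ⟨n, hnot, hN₀n, hNn, hn⟩ := ((frequently_not_robin_of_not_RH hRH).and_eventually hev).exists
  exact hnot (h n (hN n (hV n hN₀n hnot) hNn) hn)

/-! ### Parity currency: the even numbers (co-infinite, density 1/2) -/

/-- Violators `> 9` are even (CLMS 2007 Thm 2.1, tree `robinInequality_of_odd`). -/
theorem even_of_not_robin {n : ℕ} (hn : 9 < n) (h : ¬ robinInequality n) : Even n := by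
  by_contra hodd
  rw [Nat.not_even_iff_odd] at hodd
  refine h (robinInequality_of_odd hodd ?_)
  simp only [Finset.mem_insert, Finset.mem_singleton]
  omega

/-- **Robin on the even numbers beyond any `N` implies RH** (unconditional, FIN-free). -/
theorem rh_of_robin_even_tail (N : ℕ) (h : ∀ n : ℕ, N < n → Even n → robinInequality n) :
    _root_.RiemannHypothesis :=
  rh_of_tailOn_of_sieve (S := {n | N < n ∧ Even n}) (V := {n | Even n}) (N₀ := 9)
    (fun _ hn hnot => even_of_not_robin hn hnot) ⟨N, fun _ hn hNn => ⟨hNn, hn⟩⟩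
    (fun n hn _ => h n hn.1 hn.2)

/-! ### Square currency: the non-squarefree numbers (density 1 − 6/π²) -/

/-- **Robin on the non-squarefree numbers beyond any `N` implies RH** (unconditional, FIN-free;
sieve = CLMS 2007 Thm 1.1, tree `robinInequality_of_squarefree_of_gt`). -/
theorem rh_of_robin_nonsquarefree_tail (N : ℕ)
    (h : ∀ n : ℕ, N < n → ¬ Squarefree n → robinInequality n) : _root_.RiemannHypothesis :=
  rh_of_tailOn_of_sieve (S := {n | N < n ∧ ¬ Squarefree n}) (V := {n | ¬ Squarefree n}) (N₀ := 30)
    (fun _ hn hnot hsq => hnot (robinInequality_of_squarefree_of_gt hsq hn))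
    ⟨N, fun _ hn hNn => ⟨hNn, hn⟩⟩ (fun n hn _ => h n hn.1 hn.2)

/-- Sieves intersect: Robin on the EVEN NON-SQUAREFREE numbers beyond `N` implies RH. -/
theorem rh_of_robin_even_nonsquarefree_tail (N : ℕ)
    (h : ∀ n : ℕ, N < n → Even n → ¬ Squarefree n → robinInequality n) : _root_.RiemannHypothesis :=
  rh_of_tailOn_of_sieve (S := {n | N < n ∧ Even n ∧ ¬ Squarefree n})
    (V := {n | Even n ∧ ¬ Squarefree n}) (N₀ := 30)
    (fun n hn hnot => ⟨even_of_not_robin (by omega) hnot,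
      fun hsq => hnot (robinInequality_of_squarefree_of_gt hsq hn)⟩)
    ⟨N, fun _ hn hNn => ⟨hNn, hn⟩⟩ (fun n hn _ => h n hn.1 hn.2.1 hn.2.2)

/-! ### Margin currency: the band just above the RH-line, modulo Robin's RH-free Thm 2 -/

/-- **No-band criterion, ⇐.** Modulo the named RH-free fact `Robin1984_thm2`
(`σ(n)/n ≤ e^γ log log n + C/log log n`, `C = (7/3 − e^γ log log 12) log log 12 = 0.6482…`, `n ≥ 3`):
if no `n > N` has `σ(n)/n` in the closed band `[e^γ log log n, e^γ log log n + C/log log n]`, then RH.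
(Every violator lies in the band, so the band statement is the tail in disguise.) -/
theorem rh_of_noBand (h2 : Robin1984_thm2) (N : ℕ)
    (h : ∀ n : ℕ, N < n →
      ¬ (exp eulerMascheroniConstant * Real.log (Real.log n) ≤ (σ 1 n : ℝ) / n ∧
          (σ 1 n : ℝ) / n ≤ exp eulerMascheroniConstant * Real.log (Real.log n) +
            (7 / 3 - exp eulerMascheroniConstant * Real.log (Real.log 12)) * Real.log (Real.log 12) /
              Real.log (Real.log n))) :
    _root_.RiemannHypothesis := by
  refine rh_of_tailOn_of_sieve (S := {n | N < n}) (V := Set.univ) (N₀ := 0)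
    (fun n _ _ => Set.mem_univ n) ⟨N, fun n _ hNn => hNn⟩ ?_
  intro n hNn hn
  by_contra hnot
  refine h n hNn ⟨?_, h2 n (by omega)⟩
  unfold robinInequality at hnot
  have hn0 : (0 : ℝ) < n := by exact_mod_cast (show 0 < n by omega)
  rw [le_div_iff₀ hn0]
  have := not_lt.1 hnot
  linarith [this]

end Summit.RiemannHypothesis.RiemannHypothesis.Theorems.Splittings.RobinSieveDetectors

end
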